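import Summits.ABC.ABC.Theorems.IneffectiveSubspaceUniformSadicTowerFourFlatSteepSplit
import Summits.ABC.ABC.Theorems.IneffectiveSubspaceUniformSadicTowerFourHeavyPlacesReductions

/-!
# `UniformSadicTowerFour` (stmt-ABC-14937): the crux as FLAT-QUARTER ∧ HEAVY-CORE (line `flat-steep-split`, final handle)

Composition of the two landed files of the line:
`FlatSteepSplit.uniformSadicTowerFour_iff_flat_and_heavy` (crux ⟺ flat-face ∧ heavy-places, p137179) and
`HeavyPlaces.flatFace_iff_quarter`, `HeavyPlaces.heavyPlaces_iff_heavyCore` (the dials `θ ≤ 1/4`, the budget `K`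
and the range `θ > 1` are idle, p137449).  Result (`uniformSadicTowerFour_iff_quarter_and_core`): the crux is
EQUIVALENT to the conjunction of two parameter-light, hypothesis-free regimes

* FLAT-QUARTER: `∀ ε > 0 ∃ C ∀ abc triples with every block p^{v_p(abc)} < c^{1/4}: c < C·rad₄(abc)^(1+ε)`;
* HEAVY-CORE:   `∀ θ ∈ (0,1] ∀ ε > 0 ∃ C ∀ S ≠ ∅ primes ∀ abc triples with every p ∈ S θ-heavy: c < C·M_S(abc)^(1+ε)`,

which are the child statements proposed for a route-level split of stmt-ABC-14937 (lead report
`Cruxes/UniformSadicTowerFour/Lines/flat-steep-split.promote.md`); `uniformSadicTowerFour_of_quarter_of_core` is the glue.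
-/

-- `Summit.<Summit>.<Problem>` is the mandated summit-side namespace (CONVENTIONS §2); for the
-- single-conjunct summit `ABC` the two coincide, so the duplicate `ABC.ABC` is deliberate.
set_option linter.dupNamespace false

namespace Summit.ABC.ABC.Theorems.UniformSadicTowerFour.FlatSteepSplit

open Literature.NumberTheory.DiophantineGeometry (IsABCTriple)
open Summit.ABC.ABC.Theses.IneffectiveSubspace
open Summit.ABC.ABC.Theorems.UniformSadicTowerFour.HeavyPlaces
  (flatFace_iff_quarter stub_heavyPlaces_of_heavyCore heavyCore_of_heavyPlaces)
open scoped BigOperators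

/-- **Glue for the sharpened children (registered stub `uniformSadicTowerFour_of_quarter_of_core`)**:
FLAT-QUARTER → HEAVY-CORE → `UniformSadicTowerFour`. [folklore] -/
theorem uniformSadicTowerFour_of_quarter_of_core
    (h₁ : ∀ ε : ℝ, 0 < ε → ∃ C : ℝ, 0 < C ∧ ∀ a b c : ℕ, IsABCTriple a b c →
      (∀ p ∈ (a * b * c).primeFactors,
        ((p ^ (a * b * c).factorization p : ℕ) : ℝ) < (c : ℝ) ^ (1 / 4 : ℝ)) →
      (c : ℝ) < C * ((∏ p ∈ (a * b * c).primeFactors,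
        p ^ (((a * b * c).factorization p + 3) / 4) : ℕ) : ℝ) ^ (1 + ε))
    (h₂ : ∀ θ : ℝ, 0 < θ → θ ≤ 1 → ∀ ε : ℝ, 0 < ε → ∃ C : ℝ, 0 < C ∧ ∀ S : Finset ℕ, S.Nonempty →
      (∀ p ∈ S, Nat.Prime p) → ∀ a b c : ℕ, IsABCTriple a b c →
      (∀ p ∈ S, (c : ℝ) ^ θ ≤ ((p ^ (a * b * c).factorization p : ℕ) : ℝ)) →
      (c : ℝ) < C * ((((∏ p ∈ S, p) *
        ∏ p ∈ (a * b * c).primeFactors \ S, p ^ (((a * b * c).factorization p + 3) / 4) : ℕ) : ℝ)) ^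
          (1 + ε)) :
    UniformSadicTowerFour :=
  uniformSadicTowerFour_of_flat_of_heavy (flatFace_iff_quarter.mpr h₁) (stub_heavyPlaces_of_heavyCore h₂)

/-- **The crux as FLAT-QUARTER ∧ HEAVY-CORE** (lossless: both children are instances of the crux).
[folklore] -/
theorem uniformSadicTowerFour_iff_quarter_and_core :
    UniformSadicTowerFour ↔
      ((∀ ε : ℝ, 0 < ε → ∃ C : ℝ, 0 < C ∧ ∀ a b c : ℕ, IsABCTriple a b c →
        (∀ p ∈ (a * b * c).primeFactors,
          ((p ^ (a * b * c).factorization p : ℕ) : ℝ) < (c : ℝ) ^ (1 / 4 : ℝ)) →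
        (c : ℝ) < C * ((∏ p ∈ (a * b * c).primeFactors,
          p ^ (((a * b * c).factorization p + 3) / 4) : ℕ) : ℝ) ^ (1 + ε)) ∧
      (∀ θ : ℝ, 0 < θ → θ ≤ 1 → ∀ ε : ℝ, 0 < ε → ∃ C : ℝ, 0 < C ∧ ∀ S : Finset ℕ, S.Nonempty →
        (∀ p ∈ S, Nat.Prime p) → ∀ a b c : ℕ, IsABCTriple a b c →
        (∀ p ∈ S, (c : ℝ) ^ θ ≤ ((p ^ (a * b * c).factorization p : ℕ) : ℝ)) →
        (c : ℝ) < C * ((((∏ p ∈ S, p) *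
          ∏ p ∈ (a * b * c).primeFactors \ S, p ^ (((a * b * c).factorization p + 3) / 4) : ℕ) : ℝ)) ^
            (1 + ε))) :=
  ⟨fun hU => ⟨flatFace_iff_quarter.mp (flatFace_of_uniformSadicTowerFour hU),
      heavyCore_of_heavyPlaces (heavyPlaces_of_uniformSadicTowerFour hU)⟩,
    fun h => uniformSadicTowerFour_of_quarter_of_core h.1 h.2⟩

end Summit.ABC.ABC.Theorems.UniformSadicTowerFour.FlatSteepSplit
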